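import Summits.AtomisticToContinuum.Crystallization.Theorems.PerronTransitivityNoFractionalGainPeriodicWeightedForm
import Summits.AtomisticToContinuum.Crystallization.Theorems.ChargedEnergyGap.Negative.Periodisation

/-!
# The periodic weighted form implies K* — so K* IS its periodic (k = 0 Bloch) form

Support file for crux `PerronTransitivity.NoFractionalGain` (K*, stmt-AtomisticToContinuum-15098),
converse of `PerronTransitivityNoFractionalGainPeriodicWeightedForm`:

* `noFractionalGain_of_periodicWeightedForm` — if EVERY periodic configuration `Q` of `ℝ³` and every
  non-negative cell-periodic weight `W` satisfy
  `2E*·Σ_{x ∈ F} W(x)² ≤ Σ_{x ∈ F} W(x)·Σ'_{q ∈ Q, q ≠ x} W(q)·V_LJ(dist x q)`, then K* holds;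
* `noFractionalGain_iff_periodicWeightedForm` — hence **K* ⇔ its periodic weighted form**: the crux
  is exactly the statement "for every periodic `Q`, the copositive value of the `k = 0` Bloch symbol
  of the binding kernel `[−V_LJ]` is at most `2|E*|`" — the object every numerical test of K*
  computes, and a purely periodic restatement a future prover or refuter may work with instead.

PROOF of the converse: periodise the finite injective configuration `x` with the cubic lattice of
period `L = 2Σ‖xᵢ‖ + 2` (tree `ChargedEnergyGapNegative.periodise`; distinct copies are `≥ 2`
apart, where `V_LJ ≤ 0`) and extend the weights `c` cell-periodically
(`W(p) = Σⱼ cⱼ·1[p − xⱼ ∈ Lℤ³]`, so `W(x_k) = c_k`).  The periodic weighted form for `(periodise x, W)`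
has left-hand side `2E*·Σcᵢ²` and right-hand side `≤ Σᵢ Σ_{k ≠ i} cᵢc_kV_ik`, because the cross-copy
terms carry non-negative weights and non-positive potential values.  All `[folklore]`.
-/

noncomputable section

namespace Summit.AtomisticToContinuum.Crystallization.Theorems.PerronTransitivity.NoFractionalGain

open Literature.MathematicalPhysics.StatisticalMechanics
open Summit.AtomisticToContinuum.Crystallization.Theorems.ChargedEnergyGapNegative
open scoped BigOperators

section Converse

variable {N : ℕ} {x : Fin N → EuclideanSpace ℝ (Fin 3)}

/-- The cell-periodic extension `W(p) = Σⱼ cⱼ·1[p − xⱼ ∈ G]` of non-negative weights is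
non-negative. [folklore] -/
theorem periodicWeight_nonneg (G : Submodule ℤ (EuclideanSpace ℝ (Fin 3))) (c : Fin N → ℝ)
    (hc : ∀ i, 0 ≤ c i) (p : EuclideanSpace ℝ (Fin 3)) :
    0 ≤ ∑ j, (G : Set (EuclideanSpace ℝ (Fin 3))).indicator (fun _ => c j) (p - x j) :=
  Finset.sum_nonneg fun j _ => Set.indicator_nonneg (fun _ _ => hc j) _

/-- … and cell-periodic. [folklore] -/
theorem periodicWeight_add (G : Submodule ℤ (EuclideanSpace ℝ (Fin 3))) (c : Fin N → ℝ)
    (p : EuclideanSpace ℝ (Fin 3)) {g : EuclideanSpace ℝ (Fin 3)} (hg : g ∈ G) :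
    ∑ j, (G : Set (EuclideanSpace ℝ (Fin 3))).indicator (fun _ => c j) (p + g - x j) =
      ∑ j, (G : Set (EuclideanSpace ℝ (Fin 3))).indicator (fun _ => c j) (p - x j) := by
  refine Finset.sum_congr rfl fun j _ => ?_
  have hiff : p + g - x j ∈ (G : Set (EuclideanSpace ℝ (Fin 3))) ↔
      p - x j ∈ (G : Set (EuclideanSpace ℝ (Fin 3))) := by
    rw [show p + g - x j = (p - x j) + g by abel]
    exact G.add_mem_iff_left hg
  by_cases h : p - x j ∈ (G : Set (EuclideanSpace ℝ (Fin 3)))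
  · rw [Set.indicator_of_mem h, Set.indicator_of_mem (hiff.2 h)]
  · rw [Set.indicator_of_notMem h, Set.indicator_of_notMem (mt hiff.1 h)]

/-- … and restricts to `c` on the motif of the periodisation: `W(x_k) = c_k` (distinct `xⱼ` are
inequivalent modulo the lattice of the periodisation). [folklore] -/
theorem periodicWeight_apply_self (hx : Function.Injective x) (c : Fin N → ℝ) (L : ℝˣ)
    (hL : period x ≤ (L : ℝ)) (hN : 0 < N) (k : Fin N) :
    ∑ j, ((periodise x L hL hN).lattice : Set (EuclideanSpace ℝ (Fin 3))).indicator
        (fun _ => c j) (x k - x j) = c k := by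
  rw [Finset.sum_eq_single k]
  · rw [sub_self, Set.indicator_of_mem (by exact (periodise x L hL hN).lattice.zero_mem)]
  · intro j _ hjk
    refine Set.indicator_of_notMem (fun hmem => hjk ?_) _
    have hxk : x k ∈ (periodise x L hL hN).motif := by
      rw [motif_periodise]; exact Finset.mem_image_of_mem x (Finset.mem_univ _)
    have hxj : x j ∈ (periodise x L hL hN).motif := by
      rw [motif_periodise]; exact Finset.mem_image_of_mem x (Finset.mem_univ _)
    exact (hx ((periodise x L hL hN).eq_of_sub_mem (x k) hxk (x j) hxj hmem)).symm
  · exact fun h => absurd (Finset.mem_univ k) h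

/-- **Weighted lattice sums of the periodisation are at most the finite weighted site sums**:
with a non-negative weight `W` equal to `c_k` at `x_k`,
`Σ'_{y ∈ periodise x, y ≠ xᵢ} W(y)·V_LJ(dist xᵢ y) ≤ Σ_{k ≠ i} c_k·V_LJ(dist xᵢ x_k)` — the remaining
terms have `W ≥ 0` and `V_LJ ≤ 0` (distance `≥ 2`). [folklore] -/
theorem wtsum_periodise_le (hx : Function.Injective x) (L : ℝˣ) (hL : period x ≤ (L : ℝ))
    (hN : 0 < N) {W : EuclideanSpace ℝ (Fin 3) → ℝ} {M : ℝ} (hW0 : ∀ p, 0 ≤ W p)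
    (hWM : ∀ q ∈ (periodise x L hL hN).points, |W q| ≤ M) {c : Fin N → ℝ}
    (hWx : ∀ k, W (x k) = c k) (i : Fin N) :
    (∑' y : {y : EuclideanSpace ℝ (Fin 3) // y ∈ (periodise x L hL hN).points ∧ y ≠ x i},
        W y.1 * lennardJones (dist (x i) y.1)) ≤
      ∑ k ∈ Finset.univ.erase i, c k * lennardJones (dist (x i) (x k)) := by
  set P := periodise x L hL hN with hP
  set f : {y : EuclideanSpace ℝ (Fin 3) // y ∈ P.points ∧ y ≠ x i} → ℝ :=
    fun y => W y.1 * lennardJones (dist (x i) y.1) with hf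
  have hsum : Summable f := summable_weight_mul_lennardJones P hWM (x i)
  have hmem : ∀ k : {k // k ∈ Finset.univ.erase i}, x k.1 ∈ P.points ∧ x k.1 ≠ x i := fun k =>
    ⟨P.mem_points_of_mem_motif (by
        rw [hP, motif_periodise]; exact Finset.mem_image_of_mem x (Finset.mem_univ _)),
      hx.ne (Finset.ne_of_mem_erase k.2)⟩
  set emb : {k // k ∈ Finset.univ.erase i} → {y : EuclideanSpace ℝ (Fin 3) // y ∈ P.points ∧ y ≠ x i} :=
    fun k => ⟨x k.1, hmem k⟩ with hemb
  have hinj : Function.Injective emb := by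
    intro k l hkl
    have h1 : x k.1 = x l.1 := congrArg Subtype.val hkl
    exact Subtype.ext (hx h1)
  set s₀ : Finset {y : EuclideanSpace ℝ (Fin 3) // y ∈ P.points ∧ y ≠ x i} :=
    (Finset.univ.erase i).attach.image emb with hs₀
  have hsign : ∀ y ∉ s₀, 0 ≤ (fun b => -f b) y := by
    intro y hy
    have hfar : ∀ j, y.1 ≠ x j := by
      intro j hj
      by_cases hji : j = i
      · exact y.2.2 (hji ▸ hj)
      · exact hy (Finset.mem_image.2 ⟨⟨j, Finset.mem_erase.2 ⟨hji, Finset.mem_univ j⟩⟩,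
          Finset.mem_attach _ _, Subtype.ext hj.symm⟩)
    have h1 := two_le_dist_of_mem_points x L hL hN i y.2.1 hfar
    have hV : lennardJones (dist (x i) y.1) ≤ 0 := lennardJones_nonpos (by linarith)
    have hWy : 0 ≤ W y.1 := hW0 _
    simp only [hf, neg_nonneg]
    exact mul_nonpos_of_nonneg_of_nonpos hWy hV
  have h1 := sum_le_hasSum s₀ hsign hsum.hasSum.neg
  have h2 : ∑ y ∈ s₀, f y = ∑ k ∈ Finset.univ.erase i, c k * lennardJones (dist (x i) (x k)) := by
    rw [hs₀, Finset.sum_image fun k _ l _ h => hinj h]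
    refine (Finset.sum_attach (Finset.univ.erase i)
      (fun k => W (x k) * lennardJones (dist (x i) (x k)))).trans ?_
    exact Finset.sum_congr rfl fun k _ => by rw [hWx k]
  rw [Finset.sum_neg_distrib, h2] at h1
  linarith

end Converse

/-- **The periodic weighted form implies K*.** [folklore] -/
theorem noFractionalGain_of_periodicWeightedForm
    (h : ∀ (Q : PeriodicConfiguration 3) (W : EuclideanSpace ℝ (Fin 3) → ℝ), (∀ p, 0 ≤ W p) →
      (∀ p, ∀ g ∈ Q.lattice, W (p + g) = W p) →
      2 * (⨅ P : PeriodicConfiguration 3, P.energyPerParticle lennardJones) * ∑ x ∈ Q.motif, W x ^ 2 ≤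
        ∑ x ∈ Q.motif, W x * ∑' q : {q : EuclideanSpace ℝ (Fin 3) // q ∈ Q.points ∧ q ≠ x},
          W q.1 * lennardJones (dist x q.1)) :
    Summit.AtomisticToContinuum.Crystallization.Theses.PerronTransitivity.NoFractionalGain := by
  intro N x hx c hc
  rcases Nat.eq_zero_or_pos N with rfl | hN
  · simp
  -- periodise and extend the weights
  set P := periodise x (periodUnit x) le_rfl hN with hP
  set W : EuclideanSpace ℝ (Fin 3) → ℝ := fun p =>
    ∑ j, (P.lattice : Set (EuclideanSpace ℝ (Fin 3))).indicator (fun _ => c j) (p - x j) with hW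
  have hW0 : ∀ p, 0 ≤ W p := fun p => periodicWeight_nonneg P.lattice c hc p
  have hWper : ∀ p, ∀ g ∈ P.lattice, W (p + g) = W p := fun p g hg =>
    periodicWeight_add P.lattice c p hg
  have hWx : ∀ k, W (x k) = c k := fun k => periodicWeight_apply_self hx c (periodUnit x) le_rfl hN k
  -- `0 ≤ W ≤ M` on the periodisation
  have hWM : ∀ q ∈ P.points, |W q| ≤ ∑ y ∈ P.motif, W y := fun q hq => by
    rw [abs_of_nonneg (hW0 q)]; exact weight_le_sum_motif P hW0 hWper hq
  have key := h P W hW0 hWper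
  -- the motif is `{xᵢ}`
  have hmotif : P.motif = Finset.univ.image x := motif_periodise x _ _ hN
  rw [hmotif, Finset.sum_image fun i _ j _ h => hx h, Finset.sum_image fun i _ j _ h => hx h] at key
  simp only [hWx] at key
  refine key.trans (Finset.sum_le_sum fun i _ => ?_)
  rw [show ∑ j ∈ Finset.univ.erase i, c i * c j * lennardJones (dist (x i) (x j)) =
      c i * ∑ j ∈ Finset.univ.erase i, c j * lennardJones (dist (x i) (x j)) by
    rw [Finset.mul_sum]; exact Finset.sum_congr rfl fun j _ => by ring]
  exact mul_le_mul_of_nonneg_left (wtsum_periodise_le hx (periodUnit x) le_rfl hN hW0 hWM hWx i)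
    (hc i)

/-- **K* is exactly its periodic weighted (k = 0 Bloch) form.** [folklore] -/
theorem noFractionalGain_iff_periodicWeightedForm : Summit.AtomisticToContinuum.Crystallization.Theses.PerronTransitivity.NoFractionalGain ↔ ∀ (Q : PeriodicConfiguration 3) (W : EuclideanSpace ℝ (Fin 3) → ℝ), (∀ p, 0 ≤ W p) → (∀ p, ∀ g ∈ Q.lattice, W (p + g) = W p) → 2 * (⨅ P : PeriodicConfiguration 3, P.energyPerParticle lennardJones) * ∑ x ∈ Q.motif, W x ^ 2 ≤ ∑ x ∈ Q.motif, W x * ∑' q : {q : EuclideanSpace ℝ (Fin 3) // q ∈ Q.points ∧ q ≠ x}, W q.1 * lennardJones (dist x q.1) :=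
  ⟨fun hK Q W hW0 hWper => periodicWeightedForm_of_noFractionalGain hK Q W hW0 hWper,
    noFractionalGain_of_periodicWeightedForm⟩

end Summit.AtomisticToContinuum.Crystallization.Theorems.PerronTransitivity.NoFractionalGain

end
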